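import Literature.NumberTheory.Automorphic.LanglandsTunnellReduction
import Literature.NumberTheory.Automorphic.LanglandsTunnellModThree
import Literature.NumberTheory.GaloisRepresentations.ArtinCharacterReciprocityProofs
import Literature.NumberTheory.Automorphic.TunnellOctahedralGlobalProofs
import Literature.NumberTheory.Automorphic.PiOfArtinRepFrobSatakeCompatibleProofs
import HarnessLib

/-!
# Stub-ideation k = 2, GENERATION 8 (home family 2 — RESHAPE) for `stub_modThree`:
# the regime split of the typed stub read against the TREE's leaf decomposition of
# Langlands–Tunnell (`langlands_tunnell_of_leaves`, 11 leaves, 3 discharged).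

Companion of `STUB-IDEAS-stub_modThree-2.md` (gen 8).  Nothing registered; the stub statement is
copied verbatim as `SigStubModThree`.  Kernel-checked here:

* `stubModThree_of_open_leaves` — the typed stub from the EIGHT currently open leaves (the three
  proved leaves `artinReciprocity_character_holds`, `exists_twist_quadraticSign_holds`,
  `frobSatakeCompatibleAt_of_isPiOfArtinRep_holds` discharged); this is the stub's exact trust
  base today and the one-line closer the day the eight `_holds` land.
* `langlands_tunnell_of_isDihedralType_at` — per-`σ` Langlands–Tunnell in the dihedral cell from
  the dihedral case of strong Artin alone (pattern of the tree's `langlands_tunnell_of_strongArtin`).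
* `stubModThree_cellD_of_two_leaves` — cell D (dihedral-type lift) of the stub hangs on exactly
  TWO open leaves {`automorphicInduction_character`, `exists_isNewform1_of_isPiOfArtinRep`},
  modulo the S-sized per-`σ` dictionary `H1` (proved in k1's gen-2 companion, to be ported).

Helper stubs (sorry): `H1_isModular_of_langlands_tunnell_at` (port), `H2_not_isTetrahedralType`
(port of k1 H2), both S.
-/

noncomputable section

open scoped MatrixGroups NumberField
open Literature.NumberTheory.EllipticCurves
open Literature.NumberTheory.Automorphic
open Literature.NumberTheory.GaloisRepresentations
open WeierstrassCurve

set_option linter.dupNamespace false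

namespace Summit.ABC.ABC.Cruxes.FreyModularity.StubModThreeIdeasK2G8

/-- The registered stub statement, verbatim. -/
def SigStubModThree : Prop :=
  ∀ (W : WeierstrassCurve ℚ) [W.IsElliptic] (ρ : ModPGaloisRep ℚ (ZMod 3) 2),
    W.IsTorsionGaloisRep 3 ρ → FramedRep.IsAbsolutelyIrreducible ρ → ρ.IsModular

/-! ## R1 — the stub from the eight OPEN leaves of the tree's Langlands–Tunnell decomposition -/

/-- **R1 (PROVED).** The typed stub from the eight open leaves; the three discharged leaves are
fed by their `_holds` theorems. -/
theorem stubModThree_of_open_leaves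
    (hAI : automorphicInduction_character)
    (hdesc3 : exists_cuspidal_descent_det_cubic) (hGJ : GelbartJacquet_adjoint_lift)
    (hJS : JacquetShalika_eq_of_rsData_eq) (hdesc : cuspidal_descent_cyclic)
    (ha : ArthurClozel_fibres_quadratic) (hb : tunnell_cuspidal_cubic_lifts)
    (hW1 : exists_isNewform1_of_isPiOfArtinRep) : SigStubModThree :=
  fun W _ ρ hρ habs ↦
    W.isModular_of_isTorsionGaloisRep_three_of_langlands_tunnell
      (langlands_tunnell_of_leaves artinReciprocity_character_holds hAI hdesc3 hGJ hJS hdesc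
        exists_twist_quadraticSign_holds ha hb frobSatakeCompatibleAt_of_isPiOfArtinRep_holds hW1)
      ρ hρ habs

/-! ## R2 — cell D (dihedral-type lift) costs two open leaves -/

/-- **Per-`σ` Langlands–Tunnell in the dihedral cell (PROVED)**: pattern of the tree's
`langlands_tunnell_of_strongArtin`, with the dihedral case of strong Artin in place of the
solvable one. -/
theorem langlands_tunnell_of_isDihedralType_at (hd : strongArtin_of_isDihedralType)
    (hAE : frobSatakeCompatibleAt_of_isPiOfArtinRep) (hW1 : exists_isNewform1_of_isPiOfArtinRep)
    (σ : FramedArtinRep ℚ 2) (hD : IsDihedralType σ.toMonoidHom) : langlands_tunnell σ := by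
  intro hirr hodd _hsolv
  obtain ⟨hcpt, π, hπ⟩ := hd σ hirr hD
  obtain ⟨N, hN, f, hf, -, hsat⟩ := hW1 hcpt σ π hirr hodd hπ
  refine ⟨N, hN, f, hf, fun v hv => ?_⟩
  obtain ⟨α, hα, hpoly⟩ := hsat v hv
  obtain ⟨hur, hchar⟩ := hAE hcpt σ π hπ v α hα
  exact ⟨hur, hpoly ▸ hchar⟩

/-- **H1 (helper, S, PORT)** — the per-`σ` dictionary: the tree theorem
`ModPGaloisRep.isModular_of_isAbsolutelyIrreducible_of_isOdd_of_langlands_tunnell`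
(`LanglandsTunnellModThree` l. 455) uses its hypothesis `hLT : ∀ σ, langlands_tunnell σ` ONLY at
`σ = modThreeLift ρ` (l. 467); generalise that binder.  Proved verbatim in k1's gen-2 companion
`STUB_IDEAS_stub_modThree_1.lean` (`…K1G2.isModular_of_langlands_tunnell_at`); to be landed as a
Literature *Proofs* theorem. -/
theorem H1_isModular_of_langlands_tunnell_at (ρ : ModPGaloisRep ℚ (ZMod 3) 2)
    (hLT : langlands_tunnell (modThreeLift ρ)) (habs : FramedRep.IsAbsolutelyIrreducible ρ)
    (hodd : FramedGaloisRep.IsOdd ρ) : ρ.IsModular := by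
  sorry

/-- **H2 (helper, S, PORT)** — the tetrahedral cell is EMPTY: an odd `ρ̄ : Γ_ℚ → GL₂(𝔽₃)` has
`det ρ̄(c) = -1`, whereas a tetrahedral projective image `A₄ = PSL₂(𝔽₃)` forces
`ρ̄(Γ) ⊆ SL₂(𝔽₃)·{±1} = SL₂(𝔽₃)`.  Proved in k1's gen-2 companion (`…K1G2`, H2). -/
theorem H2_not_isTetrahedralType (ρ : ModPGaloisRep ℚ (ZMod 3) 2) (hodd : FramedGaloisRep.IsOdd ρ) :
    ¬ IsTetrahedralType (modThreeLift ρ).toMonoidHom := by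
  sorry

/-- Oddness of `ρ̄_{E,3}` from the Weil pairing (tree: `det ρ̄_{E,3} = χ̄₃`), exactly as in the
tree's `WeierstrassCurve.isModular_of_isTorsionGaloisRep_three_of_langlands_tunnell`. -/
theorem isOdd_of_isTorsionGaloisRep_three (W : WeierstrassCurve ℚ) [W.IsElliptic]
    (ρ : ModPGaloisRep ℚ (ZMod 3) 2) (hρ : W.IsTorsionGaloisRep 3 ρ) : FramedGaloisRep.IsOdd ρ := by
  haveI : NeZero ((3 : ℕ) : ℚ) := ⟨by norm_num⟩
  intro φ c hc
  rw [W.det_eq_modPCyclotomicCharacter_of_isTorsionGaloisRep_holds 3 ρ hρ c]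
  ext
  rw [modPCyclotomicCharacterZMod_eq_modNCyclotomicCharacter,
    modNCyclotomicCharacter_of_isComplexConjugation hc, Units.val_neg, Units.val_one]

/-- **R2 (PROVED modulo H1).**  Cell D of the typed stub — `σ = Ψ ∘ ρ̄` of dihedral type, i.e.
`ρ̄(Γ)` inside the normaliser of a Cartan but not the Cartan — hangs on exactly two open leaves:
automorphic induction of characters and the weight-one dictionary (Artin reciprocity for
characters and Gelbart's Prop. 4.1 being the tree THEOREMS `artinReciprocity_character_holds`,
`frobSatakeCompatibleAt_of_isPiOfArtinRep_holds`). -/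
theorem stubModThree_cellD_of_two_leaves (hAI : automorphicInduction_character)
    (hW1 : exists_isNewform1_of_isPiOfArtinRep) :
    ∀ (W : WeierstrassCurve ℚ) [W.IsElliptic] (ρ : ModPGaloisRep ℚ (ZMod 3) 2),
      W.IsTorsionGaloisRep 3 ρ → FramedRep.IsAbsolutelyIrreducible ρ →
        IsDihedralType (modThreeLift ρ).toMonoidHom → ρ.IsModular := by
  intro W _ ρ hρ habs hD
  have hd : strongArtin_of_isDihedralType :=
    strongArtin_of_isDihedralType_of_reciprocity_of_induction artinReciprocity_character_holds hAI
  exact H1_isModular_of_langlands_tunnell_at ρ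
    (langlands_tunnell_of_isDihedralType_at hd frobSatakeCompatibleAt_of_isPiOfArtinRep_holds hW1
      (modThreeLift ρ) hD)
    habs (isOdd_of_isTorsionGaloisRep_three W ρ hρ)

/-! ## R3 — cell O (octahedral = surjective `ρ̄`) needs ALL eight open leaves: the split is
degenerate at leaf level (cell D's two leaves are among cell O's eight). -/

/-- **R3 (PROVED).**  The octahedral case of strong Artin — hence cell O of the stub — from the
eight open leaves; note `hAI` and `hW1` (cell D's whole cost) occur here too. -/
theorem strongArtin_octahedral_of_open_leaves
    (hAI : automorphicInduction_character)
    (hdesc3 : exists_cuspidal_descent_det_cubic) (hGJ : GelbartJacquet_adjoint_lift)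
    (hJS : JacquetShalika_eq_of_rsData_eq) (hdesc : cuspidal_descent_cyclic)
    (ha : ArthurClozel_fibres_quadratic) (hb : tunnell_cuspidal_cubic_lifts) :
    strongArtin_of_isOctahedralType :=
  strongArtin_of_isOctahedralType_of_leaves artinReciprocity_character_holds hAI hdesc3 hGJ hJS hdesc
    exists_twist_quadraticSign_holds ha hb

end Summit.ABC.ABC.Cruxes.FreyModularity.StubModThreeIdeasK2G8

end
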